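import Summits.Ventures.CertifiedQuantumChemistry.Hamiltonians.Tables
import HarnessLib

/-!
# Ventures/CertifiedQuantumChemistry — Hamiltonians/FeH2OpTzdkB20Eri2.lean: two-electron table of `feH2OpTzdkB20`, part 2/2

HONEST FRAMING (verbatim): certified bounds for a stated model Hamiltonian in a stated basis; not a
claim about the real molecule or material beyond that model.

Part 2 of 2 of the canonical two-electron integral table of the literal model `feH2OpTzdkB20`
(head module `Hamiltonians/FeH2OpTzdkB20.lean`, which imports the parts, concatenates them and defines the
`Model 12`): entries 701–722 of the 722 non-zero canonical entries (sorted by key) of the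
integral file `chem-oracle/model/calib/files/feh2op_tzdk_B20.clean.fcidump` (fcidump_sha256 `3ca3c79cddcecbed2c80a9f3718570afa0cc529599952ea5f8f2f5d41328fbcf`), a file
PINNED in the LADDER-CHEM cell chem-oracle (see the head module for the MODEL PIN and its referee line).
The table is split over sibling modules only to respect the per-file line budget of the tree
(`k = 12` exceeds the single-file `k ≤ 10` class of pub-qchem ruling K3; ruling TYP-3 (e), inherited by
the chem-oracle cell). Same generator conventions as every `Hamiltonians/*.lean` literal model (reader A
exact decimals → rationals; keys = `quadKey` = reader A's `canon_eri_key`, asserted for all `k⁴` index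
tuples). Typed by chem-type-01 (cell chem-oracle, I-TYPE). Nothing is asserted here.
-/

namespace Summit.Ventures.CertifiedQuantumChemistry.Hamiltonians

/-- Two-electron integrals `(pq|rs)` of `feH2OpTzdkB20`, canonical-key table chunk 5/5 (keys `((p,q),(r,s))`, 0-based; values = (numerator, denominator)). -/
def feH2OpTzdkB20_eriTab5 : List (((ℕ × ℕ) × (ℕ × ℕ)) × (ℤ × ℕ)) := [
  (((8, 8), (10, 10)), (1288343148924969, 50000000000000000)), (((8, 8), (11, 11)), (2586600161081137, 100000000000000000)), (((8, 9), (8, 9)), (9058788908579019, 1000000000000000000)),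
  (((8, 9), (8, 10)), (-5003941829561883, 1000000000000000000000000000000)), (((8, 9), (9, 9)), (-3285290406288111, 50000000000000000000000)),
  (((8, 9), (10, 10)), (9494276447723, 500000000000000000000)), (((8, 9), (11, 11)), (530744862172147, 25000000000000000000000)),
  (((8, 10), (9, 9)), (78093232690113, 250000000000000000000000000)), (((8, 10), (10, 10)), (1405466185273893, 50000000000000000000000000)),
  (((8, 10), (11, 11)), (2106896480296129, 100000000000000000000000000)), (((8, 11), (10, 11)), (-931763171335567, 20000000000000000000000000)),
  (((9, 9), (9, 9)), (202373004434263, 625000000000000)), (((9, 9), (9, 10)), (-1104716433969847, 5000000000000000000000000000)), (((9, 9), (10, 10)), (103100103739181, 4000000000000000)),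
  (((9, 9), (11, 11)), (2587426325290033, 100000000000000000)), (((9, 10), (10, 10)), (2742598403341863, 500000000000000000000000000)),
  (((9, 10), (11, 11)), (2090988480830013, 500000000000000000000000000)), (((9, 11), (10, 11)), (-8577758729974207, 1000000000000000000000000000)),
  (((10, 10), (10, 10)), (2458942416580329, 5000000000000000)), (((10, 10), (11, 11)), (2481072462923159, 5000000000000000)), (((10, 11), (10, 11)), (16242131796997, 156250000000000)),
  (((11, 11), (11, 11)), (2796628681453119, 5000000000000000))
]

end Summit.Ventures.CertifiedQuantumChemistry.Hamiltonians
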